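import Mathlib.Tactic.LinearCombination
import Mathlib.Tactic.Abel
import Summits.MatrixMultiplication.OmegaCensus.DihedralLawModOneShapeB
import Summits.MatrixMultiplication.OmegaCensus.NearTilingPeriodic
import HarnessLib

/-!
# Dicyclic type (`c₀ ≠ 0`): a shape-B law triple forces `A/⟨c₀⟩` cyclic — additive core

ω-census, family (b3).  Framing: lottery ticket; floor = certified bounds/negative ranges.

Refinement of `DihedralLawModOneShapeBCore.two_cosets_of_shapeB` / `DihedralLawModOneShapeB.two_cosets_of_shapeB_offsets`.
In the additive normal form of a law triple of shape `(c, c+1 | 2, 2 | 1, 1)` the hypothesis (Per) says that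
`Y ⊔ (Y + t')` is `c₀`-periodic; after Step A (`t' = ±t`) the near-tiling `A = P ⊔ (P + e) ⊔ C`, `C ⊆ P + 2e`,
`|P| = |C| + 2` therefore has `P = Y ⊔ (Y + t)` PERIODIC, and `three_pieces_periodic` (`NearTilingPeriodic.lean`) gives
**`A = ⟨e⟩ ∪ (c₀ + ⟨e⟩)`** when `c₀ ≠ 0` — i.e. `A/⟨c₀⟩` is cyclic (`quot_cyclic_of_shapeB`, `quot_cyclic_of_shapeB_offsets`;
the proofs are those of the two-coset versions verbatim except for the last step).  TPP wrapper:
`DicyclicLawQuotientCyclicShapeBTPP.lean`; assembly: `DicyclicLawQuotientCyclic.lean`.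
-/

namespace Summit.MatrixMultiplication.OmegaCensus

open Finset

section ShapeB

variable {A : Type*} [AddCommGroup A] [Fintype A] [DecidableEq A]

/-- **Shape (β-ii) at `c₀ ≠ 0` forces `A = ⟨g⟩ ∪ (c₀ + ⟨g⟩)`** (hypotheses of `two_cosets_of_shapeB` plus `c₀ ≠ 0 = 2c₀`).
[folklore] -/
theorem quot_cyclic_of_shapeB {Q Y : Finset A} {t t' d c₀ : A}
    (hYt : Disjoint Y (Y.image (· + t))) (hYt' : Disjoint Y (Y.image (· + t')))
    (hQt : Disjoint Q (Q.image (· + t))) (hQt' : Disjoint Q (Q.image (· + t')))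
    (hcard : Y.card = Q.card + 1) (hA : Fintype.card A = 2 * Q.card + 4 * Y.card)
    (h12 : Disjoint (Q.image (· + (d + d)) ∪ Q.image (· + (d + d + t'))) (Y ∪ Y.image (· + t)))
    (h13 : Disjoint (Q.image (· + (d + d)) ∪ Q.image (· + (d + d + t')))
      (Y.image (· + d) ∪ Y.image (· + (d + t'))))
    (h23 : Disjoint (Y ∪ Y.image (· + t)) (Y.image (· + d) ∪ Y.image (· + (d + t'))))
    (k12 : Disjoint (Q.image (· + (d + d)) ∪ Q.image (· + (d + d - t)))
      (Y.image (· + c₀) ∪ Y.image (· + (c₀ - t'))))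
    (k13 : Disjoint (Q.image (· + (d + d)) ∪ Q.image (· + (d + d - t)))
      (Y.image (· + d) ∪ Y.image (· + (d - t))))
    (k23 : Disjoint (Y.image (· + c₀) ∪ Y.image (· + (c₀ - t'))) (Y.image (· + d) ∪ Y.image (· + (d - t))))
    (hper : (Y ∪ Y.image (· + t')).image (· + c₀) = Y ∪ Y.image (· + t'))
    (hsub : Q ∪ Q.image (· + t) ⊆ Y ∪ Y.image (· + t')) (hc₀ : c₀ ≠ 0) (h2c : c₀ + c₀ = 0) :
    ∃ g : A, ∀ x : A, x ∈ AddSubgroup.zmultiples g ∨ x + c₀ ∈ AddSubgroup.zmultiples g := by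
  obtain ⟨y₀, hy₀, y₁, hy₁, hE⟩ := star_uncovered hYt hYt' hQt hcard hsub
  have key := shapeB_char_identity hYt hYt' hQt hQt' hA h12 h13 h23 k12 k13 k23 hper hsub hE hy₀ hy₁
  -- Step A: `t' = ± t`
  have htt : t' = t ∨ t' = -t := by
    by_contra hcon
    obtain ⟨ht1, ht2⟩ := not_or.1 hcon
    have hu : t - t' ≠ 0 := fun h => ht1 (sub_eq_zero.1 h).symm
    have hv : t + t' ≠ 0 := fun h => ht2 (eq_neg_of_add_eq_zero_right h)
    have hz : y₁ + t' ≠ y₀ := fun h => disjoint_left.1 hYt' hy₀ (mem_image.2 ⟨y₁, hy₁, h⟩)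
    have hz' : y₀ ≠ y₁ + t' := fun h => hz h.symm
    have hzt : y₁ + t' + (t - t') ≠ y₀ := by
      intro h
      have e : y₁ + t = y₀ := by rw [← h]; abel
      exact disjoint_left.1 hYt hy₀ (mem_image.2 ⟨y₁, hy₁, e⟩)
    have n1 : ¬ (y₀ + (t - t') = y₀) := fun h => hu (add_left_cancel (h.trans (add_zero y₀).symm))
    have n2 : ¬ (y₀ + (t + t') = y₀) := fun h => hv (add_left_cancel (h.trans (add_zero y₀).symm))
    have m1 : ¬ (y₁ + t' + (t - t') = y₁ + t') :=
      fun h => hu (add_left_cancel (h.trans (add_zero (y₁ + t')).symm))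
    have m2 : ¬ (y₁ + t' + (t + t') = y₁ + t') :=
      fun h => hv (add_left_cancel (h.trans (add_zero (y₁ + t')).symm))
    have I1 := two_point_inversion key y₀
    have I2 := two_point_inversion key (y₁ + t')
    rw [if_pos rfl, if_neg n1, if_neg n2, if_neg hz, if_neg hzt] at I1
    have hU2 : y₁ + t' + (t + t') = y₀ := by
      by_contra h; rw [if_neg h] at I1; split_ifs at I1 <;> omega
    have hU1 : ¬ (y₀ + (t - t') + (t + t') = y₀) := by
      intro h; rw [if_pos h, if_pos hU2] at I1; split_ifs at I1 <;> omega
    have h2t : (t - t') + (t + t') ≠ 0 := fun h => hU1 (by rw [add_assoc, h, add_zero])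
    have m3 : ¬ (y₁ + t' + (t - t') + (t + t') = y₁ + t') := by
      intro h
      rw [add_assoc] at h
      exact h2t (add_left_cancel (h.trans (add_zero (y₁ + t')).symm))
    have nV1 : ¬ (y₀ + (t - t') = y₁ + t') := by
      intro h
      rw [← hU2, add_assoc] at h
      have e : (t + t') + (t - t') = 0 := add_left_cancel (h.trans (add_zero (y₁ + t')).symm)
      exact h2t (by rwa [add_comm] at e)
    rw [if_neg hz', if_neg nV1, if_pos rfl, if_neg m1, if_neg m2, if_neg m3] at I2
    have hV2 : y₀ + (t + t') = y₁ + t' := by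
      by_contra h; rw [if_neg h] at I2; split_ifs at I2 <;> omega
    have h4 : (t + t') + (t + t') = 0 := by
      have h := hV2
      rw [← hU2, add_assoc] at h
      exact add_left_cancel (h.trans (add_zero (y₁ + t')).symm)
    have hy : y₁ = y₀ + t := by
      calc y₁ = y₁ + t' + (t + t') + t - ((t + t') + (t + t')) := by abel
        _ = y₀ + t - 0 := by rw [hU2, h4]
        _ = y₀ + t := sub_zero _
    exact disjoint_left.1 hYt hy₁ (mem_image.2 ⟨y₀, hy₀, hy.symm⟩)
  -- Step B: near-tiling endgame
  have cP : (Y ∪ Y.image (· + t)).card = Y.card + Y.card := card_pair_union hYt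
  have cC : (Q.image (· + (d + d)) ∪ Q.image (· + (d + d + t'))).card = Q.card + Q.card :=
    card_two_translates (disjoint_shift hQt' (d + d))
  rcases htt with h | h
  · -- `t' = t`, step `d`
    rw [eq_comm] at h
    subst h
    have hPe : (Y ∪ Y.image (· + t)).image (· + d) = Y.image (· + d) ∪ Y.image (· + (d + t)) := by
      rw [image_union, image_add_image, add_comm t d]
    have hC : Q.image (· + (d + d)) ∪ Q.image (· + (d + d + t)) ⊆
        (Y ∪ Y.image (· + t)).image (· + (d + d)) := by
      intro x hx
      rcases mem_union.1 hx with h | h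
      · obtain ⟨q, hq, rfl⟩ := mem_image.1 h
        exact mem_image.2 ⟨q, hsub (mem_union_left _ hq), rfl⟩
      · obtain ⟨q, hq, rfl⟩ := mem_image.1 h
        have hq' : q + t ∈ Y ∪ Y.image (· + t) := hsub (mem_union_right _ (mem_image.2 ⟨q, hq, rfl⟩))
        exact mem_image.2 ⟨q + t, hq', by abel⟩
    exact ⟨d, three_pieces_periodic (P := Y ∪ Y.image (· + t))
      (C := Q.image (· + (d + d)) ∪ Q.image (· + (d + d + t))) (e := d)
      h12.symm (by rw [hPe]; exact h23) (by rw [hPe]; exact h13.symm) (by rw [cP, cC]; omega)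
      (by rw [cP, cC]; omega) hC hper hc₀ h2c⟩
  · -- `t' = -t`, step `d - t`
    subst h
    have hPe : (Y ∪ Y.image (· + t)).image (· + (d + -t)) = Y.image (· + d) ∪ Y.image (· + (d + -t)) := by
      rw [image_union, image_add_image, show t + (d + -t) = d by abel, union_comm]
    have hC : Q.image (· + (d + d)) ∪ Q.image (· + (d + d + -t)) ⊆
        (Y ∪ Y.image (· + t)).image (· + (d + -t + (d + -t))) := by
      intro x hx
      rcases mem_union.1 hx with h | h
      · obtain ⟨q, hq, rfl⟩ := mem_image.1 h
        -- `q + t ∈ Y ⊔ (Y - t)`, so `q + 2t ∈ Y ⊔ (Y + t)`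
        have hq' : q + t ∈ Y ∪ Y.image (· + -t) := hsub (mem_union_right _ (mem_image.2 ⟨q, hq, rfl⟩))
        have hq'' : q + t + t ∈ Y ∪ Y.image (· + t) := by
          rcases mem_union.1 hq' with h1 | h1
          · exact mem_union_right _ (mem_image.2 ⟨q + t, h1, rfl⟩)
          · obtain ⟨p, hp, hpe⟩ := mem_image.1 h1
            refine mem_union_left _ ?_
            have : p = q + t + t := by rw [← hpe]; abel
            rwa [← this]
        exact mem_image.2 ⟨q + t + t, hq'', by abel⟩
      · obtain ⟨q, hq, rfl⟩ := mem_image.1 h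
        have hq' : q ∈ Y ∪ Y.image (· + -t) := hsub (mem_union_left _ hq)
        have hq'' : q + t ∈ Y ∪ Y.image (· + t) := by
          rcases mem_union.1 hq' with h1 | h1
          · exact mem_union_right _ (mem_image.2 ⟨q, h1, rfl⟩)
          · obtain ⟨p, hp, hpe⟩ := mem_image.1 h1
            refine mem_union_left _ ?_
            have : p = q + t := by rw [← hpe]; abel
            rwa [← this]
        exact mem_image.2 ⟨q + t, hq'', by abel⟩
    -- periodicity of `P = Y ⊔ (Y + t) = (Y ⊔ (Y − t)) + t`
    have hPper : (Y ∪ Y.image (· + t)).image (· + c₀) = Y ∪ Y.image (· + t) := by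
      have eP : (Y ∪ Y.image (· + -t)).image (· + t) = Y ∪ Y.image (· + t) := by
        rw [image_union, image_add_image, neg_add_cancel, union_comm]
        congr 1
        simp only [add_zero, Finset.image_id']
      rw [← eP, image_add_image, show t + c₀ = c₀ + t from add_comm t c₀, ← image_add_image, hper]
    exact ⟨d + -t, three_pieces_periodic (P := Y ∪ Y.image (· + t))
      (C := Q.image (· + (d + d)) ∪ Q.image (· + (d + d + -t))) (e := d + -t)
      h12.symm (by rw [hPe]; exact h23) (by rw [hPe]; exact h13.symm) (by rw [cP, cC]; omega)
      (by rw [cP, cC]; omega) hC hPper hc₀ h2c⟩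



/-- **Offset form of `quot_cyclic_of_shapeB`** (hypotheses of `two_cosets_of_shapeB_offsets` plus `c₀ ≠ 0 = 2c₀`).
[folklore] -/
theorem quot_cyclic_of_shapeB_offsets {S₀ S₁ : Finset A} {t t' d c₀ y₀ q₀ : A}
    {o₁ o₂ o₃ o₄ o₅ o₆ o₇ o₈ o₉ o₁₀ o₁₁ : A}
    (ho₁ : o₁ = q₀ + (d + d)) (ho₂ : o₂ = q₀ + (d + d + t')) (ho₃ : o₃ = y₀ + t) (ho₄ : o₄ = y₀ + d)
    (ho₅ : o₅ = y₀ + (d + t')) (ho₆ : o₆ = q₀ + (d + d - t)) (ho₇ : o₇ = y₀ + c₀) (ho₈ : o₈ = y₀ + (c₀ - t'))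
    (ho₉ : o₉ = y₀ + (d - t)) (ho₁₀ : o₁₀ = y₀ + t') (ho₁₁ : o₁₁ = q₀ + t)
    (hYt : Disjoint S₁ (S₁.image (· + t))) (hYt' : Disjoint S₁ (S₁.image (· + t')))
    (hQt : Disjoint S₀ (S₀.image (· + t))) (hQt' : Disjoint S₀ (S₀.image (· + t')))
    (hcard : S₁.card = S₀.card + 1) (hA : Fintype.card A = 2 * S₀.card + 4 * S₁.card)
    (h12 : Disjoint (S₀.image (· + o₁) ∪ S₀.image (· + o₂)) (S₁.image (· + y₀) ∪ S₁.image (· + o₃)))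
    (h13 : Disjoint (S₀.image (· + o₁) ∪ S₀.image (· + o₂)) (S₁.image (· + o₄) ∪ S₁.image (· + o₅)))
    (h23 : Disjoint (S₁.image (· + y₀) ∪ S₁.image (· + o₃)) (S₁.image (· + o₄) ∪ S₁.image (· + o₅)))
    (k12 : Disjoint (S₀.image (· + o₁) ∪ S₀.image (· + o₆)) (S₁.image (· + o₇) ∪ S₁.image (· + o₈)))
    (k13 : Disjoint (S₀.image (· + o₁) ∪ S₀.image (· + o₆)) (S₁.image (· + o₄) ∪ S₁.image (· + o₉)))
    (k23 : Disjoint (S₁.image (· + o₇) ∪ S₁.image (· + o₈)) (S₁.image (· + o₄) ∪ S₁.image (· + o₉)))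
    (hper : (S₁.image (· + y₀) ∪ S₁.image (· + o₁₀)).image (· + c₀) = S₁.image (· + y₀) ∪ S₁.image (· + o₁₀))
    (hsub : S₀.image (· + q₀) ∪ S₀.image (· + o₁₁) ⊆ S₁.image (· + y₀) ∪ S₁.image (· + o₁₀))
    (hc₀ : c₀ ≠ 0) (h2c : c₀ + c₀ = 0) :
    ∃ g : A, ∀ x : A, x ∈ AddSubgroup.zmultiples g ∨ x + c₀ ∈ AddSubgroup.zmultiples g := by
  subst ho₁ ho₂ ho₃ ho₄ ho₅ ho₆ ho₇ ho₈ ho₉ ho₁₀ ho₁₁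
  have cY : (S₁.image (· + y₀)).card = S₁.card := card_image_add S₁ y₀
  have cQ : (S₀.image (· + q₀)).card = S₀.card := card_image_add S₀ q₀
  refine quot_cyclic_of_shapeB (Q := S₀.image (· + q₀)) (Y := S₁.image (· + y₀)) (t := t) (t' := t')
    (d := d) (c₀ := c₀) ?_ ?_ ?_ ?_ (by rw [cY, cQ, hcard]) (by rw [cY, cQ, hA]) ?_ ?_ ?_ ?_ ?_ ?_ ?_ ?_ hc₀ h2c
  · simpa only [image_add_image] using disjoint_shift hYt y₀
  · simpa only [image_add_image] using disjoint_shift hYt' y₀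
  · simpa only [image_add_image] using disjoint_shift hQt q₀
  · simpa only [image_add_image] using disjoint_shift hQt' q₀
  · simpa only [image_add_image] using h12
  · simpa only [image_add_image] using h13
  · simpa only [image_add_image] using h23
  · simpa only [image_add_image] using k12
  · simpa only [image_add_image] using k13
  · simpa only [image_add_image] using k23
  · simpa only [image_add_image] using hper
  · simpa only [image_add_image] using hsub

end ShapeB

end Summit.MatrixMultiplication.OmegaCensus
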